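import Literature.NumberTheory.GaloisRepresentations.CMTypeHeckeCharacter
import Literature.NumberTheory.GaloisRepresentations.WeakAbelianDirectSummandTwistProofs
import Literature.NumberTheory.EllipticCurves.HeegnerPointsImaginaryQuadraticProofs
import HarnessLib

/-!
# `ψ ∘ c` is algebraic of type `(q, p)` for the non-trivial automorphism `c : K ≃ₐ[ℚ] K` of an
# imaginary quadratic field (O2″ of road α: the algebraicity of `λ = (ψ∘c)⁻¹`)

Cell `bsd-print-cf2`, seat `bsd-line-cf2-p1-w4` g7, crux `stmt-BirchSwinnertonDyer-20368`
`PrintCf2.SplitBadTwoRankOneOfFacts`.  Theses-free; `--supports` the crux.  The frames of road α carry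
`c : K ≃ₐ[ℚ] K`, `c ≠ 1`, and `ψ` of infinity type `(1, 0)`; the v10 triple
(`QuadraticPart.exists_v10_triple_of_frame`) needs `λ := (HeckeCharacter.galConj c ψ)⁻¹` ALGEBRAIC
(Weil's avatar).  The tree's `HeckeCharacter.HasInfinityType.galConj_complexConj` is stated for
`IsCMField.complexConj K : K ≃ₐ[K⁺] K` (automorphism over the maximal real subfield), not for a
`ℚ`-automorphism; THIS FILE gives the `ℚ`-form for imaginary quadratic `K`, by the same argument
over the general Galois action on the infinite adeles (`Automorphic.GaloisActionAdeleRing`, any base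
field):

* `embedding_apply_eq_conj_of_ne_one` — for `K` imaginary quadratic and `σ ≠ 1`, every complex
  embedding satisfies `φ(σ x) = conj (φ x)` (one infinite place; `φ ∘ σ ≠ φ`);
* `extensionEmbedding_galInfiniteCompletionMap_of_ne_one` — hence `ι_w ∘ σ_w = conj ∘ ι_w` on the
  completion `K_w` (density of `K`);
* `smul_infiniteIdeles_eq` (`σ • (x, 1) = (σ • x, 1)`), `archFactor_smul_of_ne_one`
  (`A_{p,q}(σ • x) = A_{q,p}(x)`), **`HasInfinityType.galConj_of_isImaginaryQuadratic`**
  (`ψ` of type `(p, q)` ⟹ `ψ ∘ σ` of type `(q, p)`), **`isAlgebraic_galConj_of_isImaginaryQuadratic`**,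
  **`isAlgebraic_galConj_inv_of_isImaginaryQuadratic`** (`(ψ∘σ)⁻¹` algebraic — the displayed hypothesis
  `hlam` of `exists_v10_triple_of_frame`).

HONEST FRAMING: plumbing over the tree's Galois action on adeles; closes nothing; beyond-print theorem:
no.  BSD is not proved by any of this.

References: [Weil1956] §1; [SerreAbelianLadic1968] Ch. II §2.4; [CasselsFrohlichANT1967] Ch. VII §1.1.
-/

-- the summit namespace `Summit.BirchSwinnertonDyer.BirchSwinnertonDyer` repeats the problem name by design (D-0017)
set_option linter.dupNamespace false
set_option autoImplicit false

noncomputable section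

open scoped Classical NumberField Topology ComplexConjugate
open NumberField IsDedekindDomain Filter NumberField.InfinitePlace NumberField.InfinitePlace.Completion
open Literature.NumberTheory.Automorphic Literature.NumberTheory.GaloisRepresentations
  Literature.NumberTheory.EllipticCurves

namespace Summit.BirchSwinnertonDyer.BirchSwinnertonDyer.Theorems.PrintCf2.QuadraticPart

variable {K : Type} [Field K] [NumberField K]

/-- **The non-trivial automorphism of an imaginary quadratic field is complex conjugation under every
complex embedding**: `φ(σ x) = conj (φ x)` (`φ ∘ σ` is a complex embedding defining the unique
infinite place, and `φ ∘ σ ≠ φ`). [folklore] -/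
theorem embedding_apply_eq_conj_of_ne_one (hK : IsImaginaryQuadratic K) (σ : K ≃ₐ[ℚ] K) (hσ : σ ≠ 1)
    (w : InfinitePlace K) (x : K) : w.embedding (σ x) = conj (w.embedding x) := by
  haveI : Subsingleton (InfinitePlace K) := by
    haveI : IsTotallyComplex K := hK.2
    refine Fintype.card_le_one_iff_subsingleton.mp (le_of_eq ?_)
    rw [card_eq_nrRealPlaces_add_nrComplexPlaces, IsTotallyComplex.nrRealPlaces_eq_zero K,
      hK.nrComplexPlaces_eq_one]
  set φ : K →+* ℂ := w.embedding with hφ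
  set ψ : K →+* ℂ := φ.comp (σ : K →+* K) with hψ
  have hmk : InfinitePlace.mk φ = InfinitePlace.mk ψ := Subsingleton.elim _ _
  rcases InfinitePlace.mk_eq_iff.mp hmk with h | h
  · exfalso
    apply hσ
    ext y
    exact φ.injective ((congrArg (fun f : K →+* ℂ ↦ f y) h).symm ▸ rfl : φ (σ y) = φ y)
  · have := congrArg (fun f : K →+* ℂ ↦ f x) h
    simpa [ComplexEmbedding.conjugate_coe_eq, hψ] using this.symm

/-- An automorphism of an imaginary quadratic field fixes its (unique) infinite place. [folklore] -/
theorem smul_infinitePlace_of_isImaginaryQuadratic (hK : IsImaginaryQuadratic K) (σ : K ≃ₐ[ℚ] K)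
    (w : InfinitePlace K) : σ • w = w := by
  haveI : Subsingleton (InfinitePlace K) := by
    haveI : IsTotallyComplex K := hK.2
    refine Fintype.card_le_one_iff_subsingleton.mp (le_of_eq ?_)
    rw [card_eq_nrRealPlaces_add_nrComplexPlaces, IsTotallyComplex.nrRealPlaces_eq_zero K,
      hK.nrComplexPlaces_eq_one]
  exact Subsingleton.elim _ _

/-- **`ι_w ∘ σ_w = conj ∘ ι_w` on `K_w`** for the non-trivial automorphism `σ` of an imaginary quadratic
field: the continuous extension of `σ` to the archimedean completion is complex conjugation under
`ι_w` (both sides are continuous and agree on `K`). [cite: CasselsFrohlichANT1967, Ch. VII §1.1] -/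
theorem extensionEmbedding_galInfiniteCompletionMap_of_ne_one (hK : IsImaginaryQuadratic K)
    (σ : K ≃ₐ[ℚ] K) (hσ : σ ≠ 1) (w : InfinitePlace K) (h : σ • w = w) (y : w.Completion) :
    extensionEmbedding w (galInfiniteCompletionMap σ h y) = conj (extensionEmbedding w y) := by
  refine congrFun (InfinitePlace.Completion.ext_of_coe w
    ((isometry_extensionEmbedding w).continuous.comp (continuous_galInfiniteCompletionMap ℚ σ h))
    (Complex.continuous_conj.comp (isometry_extensionEmbedding w).continuous) fun x ↦ ?_) y
  simp only [Function.comp_apply]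
  rw [galInfiniteCompletionMap_coe]
  change extensionEmbedding w ((WithAbs.toAbs w.1 (σ x) : WithAbs w.1) : w.Completion) =
    conj (extensionEmbedding w ((WithAbs.toAbs w.1 x : WithAbs w.1) : w.Completion))
  rw [extensionEmbedding_coe, extensionEmbedding_coe]
  exact embedding_apply_eq_conj_of_ne_one hK σ hσ w x

/-- `σ • (x, 1) = (σ • x, 1)` for infinite ideles (any `σ : K ≃ₐ[ℚ] K`). [folklore] -/
theorem smul_infiniteIdeles_eq (σ : K ≃ₐ[ℚ] K) (x : (InfiniteAdeleRing K)ˣ) :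
    σ • infiniteIdeles K x = infiniteIdeles K
      (Units.map (MulSemiringAction.toRingHom (K ≃ₐ[ℚ] K) (InfiniteAdeleRing K) σ).toMonoidHom x) := by
  apply Units.ext
  rw [AdeleRing.coe_smul_units]
  change σ • (((x : InfiniteAdeleRing K), (1 : FiniteAdeleRing (𝓞 K) K)) : AdeleRing (𝓞 K) K) =
    ((σ • (x : InfiniteAdeleRing K), (1 : FiniteAdeleRing (𝓞 K) K)) : AdeleRing (𝓞 K) K)
  rw [AdeleRing.smul_mk, smul_one]

/-- **`A_{p,q}(σ • x) = A_{q,p}(x)`** for the non-trivial automorphism of an imaginary quadratic field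
(the archimedean coordinate of `σ • x` is the conjugate of that of `x`). [cite: SerreAbelianLadic1968, Ch. II §2.4] -/
theorem archFactor_smul_of_ne_one (hK : IsImaginaryQuadratic K) (σ : K ≃ₐ[ℚ] K) (hσ : σ ≠ 1)
    (p q : InfinitePlace K → ℤ) (x : (InfiniteAdeleRing K)ˣ) :
    HeckeCharacter.archFactor p q
        (Units.map (MulSemiringAction.toRingHom (K ≃ₐ[ℚ] K) (InfiniteAdeleRing K) σ).toMonoidHom x) =
      HeckeCharacter.archFactor q p x := by
  rw [HeckeCharacter.archFactor_apply, HeckeCharacter.archFactor_apply]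
  refine Finset.prod_congr rfl fun w _ ↦ ?_
  have hw : σ • w = w := smul_infinitePlace_of_isImaginaryQuadratic hK σ w
  have hcoord : extensionEmbedding w
      (((Units.map (MulSemiringAction.toRingHom (K ≃ₐ[ℚ] K) (InfiniteAdeleRing K) σ).toMonoidHom x :
        (InfiniteAdeleRing K)ˣ) : InfiniteAdeleRing K) w) =
      conj (extensionEmbedding w ((x : InfiniteAdeleRing K) w)) := by
    change extensionEmbedding w ((σ • (x : InfiniteAdeleRing K)) w) = _
    rw [InfiniteAdeleRing.smul_apply,
      galInfiniteCompletionMap_apply_congr_place ℚ (InfinitePlace.inv_smul_eq_of_smul_eq hw)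
        (smul_inv_smul σ w) hw (fun u ↦ (x : InfiniteAdeleRing K) u),
      extensionEmbedding_galInfiniteCompletionMap_of_ne_one hK σ hσ w hw]
  rw [hcoord, Complex.conj_conj, ← map_zpow₀, mul_comm]

/-- **`ψ ∘ σ` has infinity type `(q, p)` if `ψ` has type `(p, q)`**, for the non-trivial
`σ : K ≃ₐ[ℚ] K` of an imaginary quadratic field (the `ℚ`-automorphism form of the tree's
`HasInfinityType.galConj_complexConj`). [cite: Weil1956, §1] [cite: SerreAbelianLadic1968, Ch. II §2.4] -/
theorem HasInfinityType.galConj_of_isImaginaryQuadratic (hK : IsImaginaryQuadratic K) (σ : K ≃ₐ[ℚ] K)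
    (hσ : σ ≠ 1) {ψ : HeckeCharacter K} {p q : InfinitePlace K → ℤ} (hψ : ψ.HasInfinityType p q) :
    (HeckeCharacter.galConj σ ψ).HasInfinityType q p := by
  obtain ⟨U, hU, h⟩ := hψ
  set f : (InfiniteAdeleRing K)ˣ →* (InfiniteAdeleRing K)ˣ :=
    (Units.map (MulSemiringAction.toRingHom (K ≃ₐ[ℚ] K) (InfiniteAdeleRing K) σ).toMonoidHom) with hf
  have hfc : Continuous f := Continuous.units_map _ (InfiniteAdeleRing.continuous_smul ℚ σ)
  refine ⟨f ⁻¹' U, ?_, fun x hx ↦ ?_⟩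
  · refine hfc.continuousAt.preimage_mem_nhds ?_
    rwa [show f (1 : (InfiniteAdeleRing K)ˣ) = 1 from map_one _]
  · rw [HeckeCharacter.galConj_apply, smul_infiniteIdeles_eq, h _ hx, archFactor_smul_of_ne_one hK σ hσ]

/-- **`ψ ∘ σ` is algebraic** for `ψ` algebraic and `σ ≠ 1` on an imaginary quadratic field.
[cite: Weil1956, §1] -/
theorem isAlgebraic_galConj_of_isImaginaryQuadratic (hK : IsImaginaryQuadratic K) (σ : K ≃ₐ[ℚ] K)
    (hσ : σ ≠ 1) {ψ : HeckeCharacter K} (hψ : ψ.IsAlgebraic) :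
    (HeckeCharacter.galConj σ ψ).IsAlgebraic := by
  obtain ⟨p, q, hpq⟩ := (HeckeCharacter.isAlgebraic_iff_exists_hasInfinityType ψ).mp hψ
  exact (HeckeCharacter.isAlgebraic_iff_exists_hasInfinityType _).mpr
    ⟨q, p, HasInfinityType.galConj_of_isImaginaryQuadratic hK σ hσ hpq⟩

/-- **`λ := (ψ ∘ c)⁻¹` is algebraic** for `ψ` of infinity type `(1, 0)` and `c ≠ 1` on an imaginary
quadratic field — the hypothesis `hlam` of `QuadraticPart.exists_v10_triple_of_frame` (Weil's avatar
of `λ` exists). [cite: Weil1956, §1] [cite: SerreAbelianLadic1968, Ch. II §2.7] -/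
theorem isAlgebraic_galConj_inv_of_isImaginaryQuadratic (hK : IsImaginaryQuadratic K)
    (c : K ≃ₐ[ℚ] K) (hc : c ≠ 1) {ψ : HeckeCharacter K}
    (hψ : ψ.HasInfinityType (fun _ ↦ 1) (fun _ ↦ 0)) :
    (HeckeCharacter.galConj c ψ)⁻¹.IsAlgebraic :=
  (isAlgebraic_galConj_of_isImaginaryQuadratic hK c hc
    ((HeckeCharacter.isAlgebraic_iff_exists_hasInfinityType ψ).mpr ⟨_, _, hψ⟩)).inv

end Summit.BirchSwinnertonDyer.BirchSwinnertonDyer.Theorems.PrintCf2.QuadraticPart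

end
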